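import Literature.InformationTheory.StateDiscrimination.RLDFisherInformation
import HarnessLib

/-!
# Quasi-classical (commuting) families: with a parameter-independent eigenbasis the SLD quantum Fisher matrix,
# the RLD Fisher information and the Fisher matrix of the eigenbasis measurement all equal the classical Fisher
# matrix of the spectrum, `Σ_i ∂_aλ_i∂_bλ_i/λ_i`; the thermal state `F_TT = (⟨H²⟩ − ⟨H⟩²)/T⁴`
# (Liu–Yuan–Lu–Wang 2020 § 2.3.1 (the «classical» term of Thm 2.1/2.2 and the SLD entries), § 3.1.3, § 2.5;
# Katariya–Wilde 2021 § 5.2.4 Prop. 7 with trivial quantum register)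

Hodge foundations lane (`lit-hodgefound`, prover p24 gen 80; quantum-information series — the bridge between the
quantum files g80-#1…#6/#8 and the classical `Probability/Divergences/FisherInformationMatrix.lean`, g80-#7).
THEOREMS ONLY: no definition, no named fact, net debt 0.  Data: a unitary `U` (`U†U = UU† = 1`, columns
`|λ_i⟩`), real eigenvalues `d i = λ_i` and their derivatives `dd a i = ∂_aλ_i` SPELLED OUT, the state
`ρ = U diag(λ) U†` and derivative data `∂_aρ = U diag(∂_aλ) U†` (the eigenvectors do not depend on the parameters),
SLDs `S_aρ + ρS_a = ∂_aρ` (BF normalisation, `L = 2S`), QFIM `hF : F a b = 2Re Tr(S_a∂_bρ)`, the classical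
Fisher matrix shape `hJ : J a b = Σ_i ∂_aλ_i∂_bλ_i/λ_i` of g80-#7, the RLD expression `Tr(∂_aρ ρ⁻¹ ∂_bρ)`, and
the eigenbasis measurement `Π_i = |λ_i⟩⟨λ_i|` with Born data `Tr(ρΠ_i)`, `Tr(∂_aρΠ_i)`.

## Sources, VERBATIM

J. Liu, H. Yuan, X.-M. Lu, X. Wang, J. Phys. A 53 (2020) 023001 [LiuYuanLuWang2020], held `paper:arxiv-1907.08037`.
§ 2.3.1 (p0005–p0006): «`𝓕_ab = Σ_i (∂_aλ_i)(∂_bλ_i)/λ_i + Σ_i 4λ_iRe(⟨∂_aλ_i|∂_bλ_i⟩) − Σ_{i,j} 8λ_iλ_j/(λ_i+λ_j)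
Re(⟨∂_aλ_i|λ_j⟩⟨λ_j|∂_bλ_i⟩)` … The first term … can be viewed as the counterpart of the classical Fisher
information as it only contains the derivatives of the eigenvalues which can be regarded as the counterpart of the
probability distribution. The other terms are purely quantum. … the entries of the SLD operator can be obtained as
follows `⟨λ_i|L_a|λ_j⟩ = δ_ij ∂_aλ_i/λ_i + 2(λ_j−λ_i)/(λ_i+λ_j) ⟨λ_i|∂_aλ_j⟩`».  § 3.1.3 (p0015): «a possible
optimal measurement can be constructed with the eigenstates of the SLD operator … In the case where `|l_i⟩` is
independent of `x_a`, the CFI then reads `𝓘_aa = Σ_i ⟨l_i|∂_aρ|l_i⟩²/⟨l_i|ρ|l_i⟩` … `= Tr(ρL_a²) = 𝓕_aa`, which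
means the POVM `{|l_i⟩⟨l_i|}` is the optimal measurement to attain the QFI.»  § 2.5 (p0012): «The density matrix
of a quantum thermal state is `ρ = e^{−βH}/Z` … `∂_Tρ = (1/T²)(⟨H⟩ − H)ρ` … the SLD … can then be obtained as
`L_T = (1/T²)(⟨H⟩ − H)`, which commutes with `ρ`. The QFI for the temperature hence reads
`𝓕_TT = (1/T⁴)(⟨H²⟩ − ⟨H⟩²)`».
V. Katariya, M. M. Wilde, Quantum Inf. Process. 20 (2021) 78 [KatariyaWilde2021], held `paper:arxiv-2004.10708`,
§ 5.2.4 (p0015): «**Proposition 7** Let `{ρ^θ_XB}` be a differentiable family of classical–quantum states,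
`ρ^θ_XB := Σ_x p_θ(x)|x⟩⟨x|_X ⊗ ρ^x_θ`. Then … `I_F(θ;{ρ^θ_XB}) = I_F(θ;{p_θ}) + Σ_x p_θ(x)I_F(θ;{ρ^x_θ})`,
`Î_F(θ;{ρ^θ_XB}) = I_F(θ;{p_θ}) + Σ_x p_θ(x)Î_F(θ;{ρ^x_θ})`» — with a trivial register `B` both reduce to the
classical Fisher information of `p_θ`; § 5.1.3 (p0014): «This formula is thus a more direct quantum generalization
of the classical formula».

## What is formalized (all PROVED)

* § 1 `conj_mul_conj`, `trace_conj`, `conjTranspose_conj_apply` (unitary bookkeeping), **`sld_commuting`**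
  (`S_a = U diag(∂_aλ/2λ) U†` solves the SLD equation: «`⟨λ_i|L_a|λ_j⟩ = δ_ij∂_aλ_i/λ_i`»), `sld_commuting_isHermitian`,
  **`qfim_commuting`** (`F_ab = Σ_i∂_aλ_i∂_bλ_i/λ_i` for ANY SLDs, any rank — the «classical» term alone),
  **`qfim_commuting_eq_fisherMatrix`** (`F = J`, the classical Fisher matrix of the spectrum, g80-#7 shape).
* § 2 `inv_commuting` (`ρ⁻¹ = U diag(1/λ) U†`), **`rldFisher_commuting`** (`Tr(∂_aρρ⁻¹∂_bρ) = Σ∂_aλ∂_bλ/λ`: SLD and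
  RLD Fisher informations coincide on commuting families, Prop. 7 with trivial `B`).
* § 3 `inner_col_mulVec_col` (`⟨λ_i|X|λ_i⟩ = (U†XU)_ii`), `born_eigenbasis`, `born_deriv_eigenbasis`,
  **`cfim_eigenbasis_eq_qfim`** (the eigenbasis measurement attains the matrix bound: its CFIM, in the shape of
  `MultiparameterQuantumCramerRaoBound.lean`, equals `F`).
* § 4 **`sld_thermal`**, **`qfi_thermal`** (`L_T = c(⟨H⟩ − H)`, `F_TT = c²(⟨H²⟩ − ⟨H⟩²)` for `ρH = Hρ`, `Tr ρ = 1`,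
  `∂_Tρ = c(⟨H⟩ − H)ρ`; printed with `c = 1/T²`).

NOT formalized: the eigenvector-derivative terms of Thm 2.2 (the «purely quantum» part), `ρ = e^{−βH}/Z` as a
matrix exponential and the derivative `∂_Tρ` (taken as data), the specific heat identity.  Tree search (FAIL-DUP,
2026-09-01): one-parameter unitary-family eigenbasis formula `QFIVariance.qfi_unitary_eq_sum_eigenbasis` (different
hypothesis: `∂ρ = i[ρ,H]`), `QFIMFormulas.qfim_eq_sum_eigenbasis` (general, used here); no commuting-family file.
-/

noncomputable section

open Matrix Finset
open scoped ComplexOrder ComplexConjugate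

namespace Literature.InformationTheory.StateDiscrimination.CommutingFamily

open Literature.InformationTheory.StateDiscrimination.QFIM (trace_sld_mul_deriv_eq_of_sld_eq)
open Literature.InformationTheory.StateDiscrimination.QFIMFormulas (qfim_eq_sum_eigenbasis)
open Literature.InformationTheory.StateDiscrimination.QFI (trace_mul_ketbra)

variable {n ι : Type*} [Fintype n] [DecidableEq n]

/-! ## § 1 The SLD quantum Fisher matrix of a commuting family is the classical Fisher matrix of the spectrum -/

/-- `(UXU†)(UYU†) = U(XY)U†` for `U†U = 1`. [folklore] -/
private theorem conj_mul_conj {U : Matrix n n ℂ} (hU : Uᴴ * U = 1) (X Y : Matrix n n ℂ) :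
    U * X * Uᴴ * (U * Y * Uᴴ) = U * (X * Y) * Uᴴ := by
  calc U * X * Uᴴ * (U * Y * Uᴴ) = U * X * (Uᴴ * U) * Y * Uᴴ := by simp only [Matrix.mul_assoc]
    _ = U * (X * Y) * Uᴴ := by rw [hU, Matrix.mul_one, Matrix.mul_assoc U X Y]

/-- `Tr(UXU†) = Tr X` for `U†U = 1`. [folklore] -/
private theorem trace_conj {U : Matrix n n ℂ} (hU : Uᴴ * U = 1) (X : Matrix n n ℂ) : (U * X * Uᴴ).trace = X.trace := by
  rw [Matrix.trace_mul_cycle, hU, Matrix.one_mul]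

/-- `U†(UXU†)U = X` for `U†U = 1`. [folklore] -/
private theorem conjTranspose_conj {U : Matrix n n ℂ} (hU : Uᴴ * U = 1) (X : Matrix n n ℂ) :
    Uᴴ * (U * X * Uᴴ) * U = X := by
  calc Uᴴ * (U * X * Uᴴ) * U = (Uᴴ * U) * X * (Uᴴ * U) := by simp only [Matrix.mul_assoc]
    _ = X := by rw [hU, Matrix.one_mul, Matrix.mul_one]

/-- **The SLD of a commuting family**: with `ρ = U diag(λ) U†`, `∂_aρ = U diag(∂_aλ) U†` and all `λ_i ≠ 0`,
`S_a := U diag(∂_aλ_i/(2λ_i)) U†` solves `S_aρ + ρS_a = ∂_aρ` (i.e. `⟨λ_i|L_a|λ_j⟩ = δ_ij∂_aλ_i/λ_i`, the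
eigenvector term being absent). [cite: LiuYuanLuWang2020, §2.3.1 (the SLD entries «`⟨λ_i|L_a|λ_j⟩ = δ_ij ∂_aλ_i/λ_i + …`»)] -/
theorem sld_commuting {U : Matrix n n ℂ} (hU : Uᴴ * U = 1) {d : n → ℝ} (hd : ∀ i, d i ≠ 0) (dd : n → ℝ) :
    (U * diagonal (fun i => ((dd i / (2 * d i) : ℝ) : ℂ)) * Uᴴ) * (U * diagonal (fun i => (d i : ℂ)) * Uᴴ) +
        (U * diagonal (fun i => (d i : ℂ)) * Uᴴ) * (U * diagonal (fun i => ((dd i / (2 * d i) : ℝ) : ℂ)) * Uᴴ) =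
      U * diagonal (fun i => (dd i : ℂ)) * Uᴴ := by
  rw [conj_mul_conj hU, conj_mul_conj hU, diagonal_mul_diagonal, diagonal_mul_diagonal, ← Matrix.add_mul,
    ← Matrix.mul_add, diagonal_add]
  refine congrArg (fun M => U * M * Uᴴ) ?_
  ext i j
  by_cases hij : i = j
  · subst hij
    simp only [diagonal_apply_eq]
    have h : (d i : ℂ) ≠ 0 := by exact_mod_cast hd i
    push_cast
    field_simp
    ring
  · simp only [diagonal_apply_ne _ hij]

/-- The SLD above is Hermitian. [cite: LiuYuanLuWang2020, §2.3.1] -/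
theorem sld_commuting_isHermitian (U : Matrix n n ℂ) (s : n → ℝ) :
    (U * diagonal (fun i => (s i : ℂ)) * Uᴴ).IsHermitian := by
  refine isHermitian_mul_mul_conjTranspose U ?_
  rw [Matrix.IsHermitian, diagonal_conjTranspose]
  congr 1
  funext i
  simp

/-- **`𝓕_ab = Σ_i ∂_aλ_i∂_bλ_i/λ_i` for a commuting family** (`ρ = U diag(λ) U†`, `∂_aρ = U diag(∂_aλ) U†`, any
SLDs, any rank — a vanishing eigenvalue contributes `0`): the QFIM is the «counterpart of the classical Fisher
information», the purely quantum terms vanish. [cite: LiuYuanLuWang2020, §2.3.1 Thm 2.1 and the remark after Thm 2.2 («The first term … counterpart of the classical Fisher information … The other terms are purely quantum»)] [cite: KatariyaWilde2021, §5.2.4 Prop. 7] -/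
theorem qfim_commuting [Fintype ι] {U : Matrix n n ℂ} (hU : Uᴴ * U = 1) (hU' : U * Uᴴ = 1) (d : n → ℝ)
    (dd : ι → n → ℝ) {ρ : Matrix n n ℂ} (hρU : ρ = U * diagonal (fun i => (d i : ℂ)) * Uᴴ)
    {S D : ι → Matrix n n ℂ} (hDU : ∀ a, D a = U * diagonal (fun i => (dd a i : ℂ)) * Uᴴ)
    (hSD : ∀ a, S a * ρ + ρ * S a = D a) {F : Matrix ι ι ℝ} (hF : ∀ a b, F a b = 2 * (S a * D b).trace.re)
    (a b : ι) : F a b = ∑ i, dd a i * dd b i / d i := by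
  rw [qfim_eq_sum_eigenbasis hU hU' d hρU hSD hF a b]
  refine Finset.sum_congr rfl fun i _ => ?_
  have hconj : ∀ c, Uᴴ * D c * U = diagonal (fun i => (dd c i : ℂ)) := fun c => by
    rw [hDU, conjTranspose_conj hU]
  rw [hconj, hconj, Finset.sum_eq_single i]
  · rw [diagonal_apply_eq, diagonal_apply_eq, ← Complex.ofReal_mul, Complex.ofReal_re]
    by_cases hdi : d i = 0
    · simp [hdi]
    · field_simp
      ring
  · intro j _ hji
    rw [diagonal_apply_ne _ (Ne.symm hji), zero_mul, Complex.zero_re, mul_zero, zero_div]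
  · intro hi
    exact absurd (Finset.mem_univ i) hi

/-- **The QFIM of a commuting family IS the classical Fisher matrix of its spectrum** (`F = J` for the Fisher
matrix `J_ab = Σ_i ∂_aλ_i∂_bλ_i/λ_i` of the eigenvalue law, the `hJ` of g80-#7 with `Ω = n`, `p = λ`, `∂p = ∂λ`).
[cite: LiuYuanLuWang2020, §2.3.1 («counterpart of the classical Fisher information»)] [cite: KatariyaWilde2021, §5.2.4 Prop. 7 (trivial register `B`)] -/
theorem qfim_commuting_eq_fisherMatrix [Fintype ι] {U : Matrix n n ℂ} (hU : Uᴴ * U = 1) (hU' : U * Uᴴ = 1)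
    (d : n → ℝ) (dd : ι → n → ℝ) {ρ : Matrix n n ℂ} (hρU : ρ = U * diagonal (fun i => (d i : ℂ)) * Uᴴ)
    {S D : ι → Matrix n n ℂ} (hDU : ∀ a, D a = U * diagonal (fun i => (dd a i : ℂ)) * Uᴴ)
    (hSD : ∀ a, S a * ρ + ρ * S a = D a) {F J : Matrix ι ι ℝ} (hF : ∀ a b, F a b = 2 * (S a * D b).trace.re)
    (hJ : ∀ a b, J a b = ∑ i, dd a i * dd b i / d i) : F = J := by
  ext a b
  rw [qfim_commuting hU hU' d dd hρU hDU hSD hF, hJ]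

/-! ## § 2 The RLD Fisher information of a commuting family -/

/-- `ρ⁻¹ = U diag(1/λ) U†` for a full-rank commuting state. [cite: KatariyaWilde2021, §5.1.3 («`ρ_θ⁻¹` is taken on the support»)] -/
theorem inv_commuting {U : Matrix n n ℂ} (hU : Uᴴ * U = 1) (hU' : U * Uᴴ = 1) {d : n → ℝ} (hd : ∀ i, d i ≠ 0) :
    (U * diagonal (fun i => (d i : ℂ)) * Uᴴ)⁻¹ = U * diagonal (fun i => ((d i : ℂ))⁻¹) * Uᴴ := by
  refine Matrix.inv_eq_left_inv ?_
  rw [conj_mul_conj hU, diagonal_mul_diagonal]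
  have h1 : (fun i => ((d i : ℂ))⁻¹ * (d i : ℂ)) = fun _ => 1 := by
    funext i
    exact inv_mul_cancel₀ (by exact_mod_cast hd i)
  rw [h1, diagonal_one, Matrix.mul_one, hU']

/-- **`Tr(∂_aρ ρ⁻¹ ∂_bρ) = Σ_i ∂_aλ_i∂_bλ_i/λ_i` for a full-rank commuting family**: the RLD Fisher information
(matrix) coincides with the SLD one and with the classical Fisher matrix of the spectrum. [cite: KatariyaWilde2021, §5.2.4 Prop. 7 (RLD line, trivial register) and §5.1.3 («a more direct quantum generalization of the classical formula»)] -/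
theorem rldFisher_commuting {U : Matrix n n ℂ} (hU : Uᴴ * U = 1) (hU' : U * Uᴴ = 1) {d : n → ℝ}
    (hd : ∀ i, d i ≠ 0) (dda ddb : n → ℝ) :
    (U * diagonal (fun i => (dda i : ℂ)) * Uᴴ * (U * diagonal (fun i => (d i : ℂ)) * Uᴴ)⁻¹ *
        (U * diagonal (fun i => (ddb i : ℂ)) * Uᴴ)).trace = ((∑ i, dda i * ddb i / d i : ℝ) : ℂ) := by
  rw [inv_commuting hU hU' hd, conj_mul_conj hU, conj_mul_conj hU, diagonal_mul_diagonal, diagonal_mul_diagonal,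
    trace_conj hU, trace_diagonal, Complex.ofReal_sum]
  refine Finset.sum_congr rfl fun i _ => ?_
  push_cast
  rw [div_eq_mul_inv]
  ring

/-! ## § 3 The eigenbasis measurement attains the bound -/

/-- `⟨λ_i|X|λ_i⟩ = (U†XU)_ii` for the `i`-th column `|λ_i⟩` of `U`. [folklore] -/
private theorem inner_col_mulVec_col (U X : Matrix n n ℂ) (i : n) :
    star (fun j => U j i) ⬝ᵥ (X *ᵥ fun j => U j i) = (Uᴴ * X * U) i i := by
  have hcol : (fun j => U j i) = U *ᵥ Pi.single i 1 := by
    rw [mulVec_single_one]; rfl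
  have h1 : star (fun j => U j i) ⬝ᵥ (X *ᵥ fun j => U j i) = (Uᴴ *ᵥ (X *ᵥ fun j => U j i)) i := by
    simp [mulVec, dotProduct, conjTranspose_apply]
  rw [h1, hcol, mulVec_mulVec, mulVec_mulVec, mulVec_single_one]
  rfl

/-- **Born probabilities in the eigenbasis**: `Tr(ρΠ_i) = λ_i` for `Π_i = |λ_i⟩⟨λ_i|`, `ρ = U diag(λ) U†`. [cite: LiuYuanLuWang2020, §3.1.3 («the probability for the `i`th measurement result is `⟨l_i|ρ|l_i⟩`»)] -/
theorem born_eigenbasis {U : Matrix n n ℂ} (hU : Uᴴ * U = 1) (x : n → ℂ) (i : n) :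
    (U * diagonal x * Uᴴ * vecMulVec (fun j => U j i) (star fun j => U j i)).trace = x i := by
  rw [trace_mul_ketbra, inner_col_mulVec_col, conjTranspose_conj hU, diagonal_apply_eq]

/-- In particular `Re Tr(ρΠ_i) = λ_i` and `Re Tr(∂_aρΠ_i) = ∂_aλ_i` for real spectra. [cite: LiuYuanLuWang2020, §3.1.3] -/
theorem born_deriv_eigenbasis {U : Matrix n n ℂ} (hU : Uᴴ * U = 1) (x : n → ℝ) (i : n) :
    (U * diagonal (fun j => (x j : ℂ)) * Uᴴ * vecMulVec (fun j => U j i) (star fun j => U j i)).trace.re = x i := by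
  rw [born_eigenbasis hU, Complex.ofReal_re]

/-- **The eigenbasis measurement attains the matrix bound for a commuting family**: the classical Fisher matrix
of the projective measurement `{|λ_i⟩⟨λ_i|}` (in the shape of `MultiparameterQuantumCramerRaoBound.lean`:
`𝓘_ab = Σ_i Tr(∂_aρΠ_i)Tr(∂_bρΠ_i)/Tr(ρΠ_i)`) equals the QFIM: `𝓘 = 𝓕` (both are `Σ_i∂_aλ_i∂_bλ_i/λ_i`).
[cite: LiuYuanLuWang2020, §3.1.3 («In the case where `|l_i⟩` is independent of `x_a` … `𝓘_aa = … = 𝓕_aa`, which means the POVM `{|l_i⟩⟨l_i|}` is the optimal measurement»)] -/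
theorem cfim_eigenbasis_eq_qfim [Fintype ι] {U : Matrix n n ℂ} (hU : Uᴴ * U = 1) (hU' : U * Uᴴ = 1) (d : n → ℝ)
    (dd : ι → n → ℝ) {ρ : Matrix n n ℂ} (hρU : ρ = U * diagonal (fun i => (d i : ℂ)) * Uᴴ)
    {S D : ι → Matrix n n ℂ} (hDU : ∀ a, D a = U * diagonal (fun i => (dd a i : ℂ)) * Uᴴ)
    (hSD : ∀ a, S a * ρ + ρ * S a = D a) {F I : Matrix ι ι ℝ} (hF : ∀ a b, F a b = 2 * (S a * D b).trace.re)
    (hI : ∀ a b, I a b = ∑ i, (D a * vecMulVec (fun j => U j i) (star fun j => U j i)).trace.re *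
      (D b * vecMulVec (fun j => U j i) (star fun j => U j i)).trace.re /
      (ρ * vecMulVec (fun j => U j i) (star fun j => U j i)).trace.re) :
    I = F := by
  ext a b
  rw [hI, qfim_commuting hU hU' d dd hρU hDU hSD hF]
  refine Finset.sum_congr rfl fun i _ => ?_
  rw [hDU, hDU, hρU, born_deriv_eigenbasis hU, born_deriv_eigenbasis hU, born_deriv_eigenbasis hU]

/-! ## § 4 The thermal state: `L_T = c(⟨H⟩ − H)`, `𝓕_TT = c²(⟨H²⟩ − ⟨H⟩²)` (`c = 1/T²`) -/

/-- **The temperature SLD of a thermal state**: if `ρH = Hρ` and `∂_Tρ = c(⟨H⟩ − H)ρ` (printed with `c = 1/T²`,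
`⟨H⟩ = Tr(ρH)`), then `S := (c/2)(⟨H⟩ − H)` solves `Sρ + ρS = ∂_Tρ`, i.e. `L_T = 2S = c(⟨H⟩ − H)` «which commutes
with `ρ`». [cite: LiuYuanLuWang2020, §2.5 («`L_T = (1/T²)(⟨H⟩ − H)`»)] -/
theorem sld_thermal {ρ H : Matrix n n ℂ} (hcomm : ρ * H = H * ρ) (c e : ℂ) :
    ((c / 2) • (e • (1 : Matrix n n ℂ) - H)) * ρ + ρ * ((c / 2) • (e • (1 : Matrix n n ℂ) - H)) =
      c • ((e • (1 : Matrix n n ℂ) - H) * ρ) := by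
  have hc2 : ρ * (e • (1 : Matrix n n ℂ) - H) = (e • (1 : Matrix n n ℂ) - H) * ρ := by
    rw [Matrix.mul_sub, Matrix.sub_mul, Matrix.mul_smul, Matrix.smul_mul, Matrix.mul_one, Matrix.one_mul, hcomm]
  rw [Matrix.smul_mul, Matrix.mul_smul, hc2, ← add_smul]
  congr 1
  ring

/-- **`𝓕_TT = c²(⟨H²⟩ − ⟨H⟩²)`** for a state commuting with a Hermitian `H`, `Tr ρ = 1`, `∂_Tρ = c(⟨H⟩ − H)ρ` with
real `c` (`= 1/T²`): the temperature QFI is `c²` times the energy fluctuation («proportional to the specific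
heat»), for ANY SLD. [cite: LiuYuanLuWang2020, §2.5 («`𝓕_TT = (1/T⁴)(⟨H²⟩ − ⟨H⟩²)`»)] -/
theorem qfi_thermal {ρ H : Matrix n n ℂ} (hρ1 : ρ.trace = 1) (hcomm : ρ * H = H * ρ) (c : ℝ) {S D : Matrix n n ℂ}
    (hD : D = (c : ℂ) • ((((ρ * H).trace) • (1 : Matrix n n ℂ) - H) * ρ)) (hSD : S * ρ + ρ * S = D) :
    2 * (S * D).trace.re = c ^ 2 * ((ρ * (H * H)).trace - (ρ * H).trace ^ 2).re := by
  have hS0 := sld_thermal hcomm (c : ℂ) (ρ * H).trace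
  rw [← hD] at hS0
  rw [trace_sld_mul_deriv_eq_of_sld_eq ρ hSD hS0 hSD, hD]
  -- `2 Tr((c/2)(e − H) · c(e − H)ρ) = c² Tr((e − H)²ρ) = c²(⟨H²⟩ − e²)` with `e = ⟨H⟩`, `Tr ρ = 1`
  have hexp : (((c : ℂ) / 2) • ((ρ * H).trace • (1 : Matrix n n ℂ) - H)) *
      ((c : ℂ) • (((ρ * H).trace • (1 : Matrix n n ℂ) - H) * ρ)) =
      ((c : ℂ) ^ 2 / 2) • (((ρ * H).trace • (1 : Matrix n n ℂ) - H) *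
        (((ρ * H).trace • (1 : Matrix n n ℂ) - H) * ρ)) := by
    rw [Matrix.smul_mul, Matrix.mul_smul, smul_smul]
    congr 1
    ring
  have htr : ((((ρ * H).trace • (1 : Matrix n n ℂ) - H) * (((ρ * H).trace • (1 : Matrix n n ℂ) - H) * ρ))).trace =
      (ρ * (H * H)).trace - (ρ * H).trace ^ 2 := by
    have h1 : (H * ρ).trace = (ρ * H).trace := Matrix.trace_mul_comm _ _
    have h2 : (H * (H * ρ)).trace = (ρ * (H * H)).trace := by rw [← Matrix.mul_assoc, Matrix.trace_mul_comm]
    simp only [Matrix.sub_mul, Matrix.mul_sub, Matrix.smul_mul, Matrix.mul_smul, Matrix.one_mul, trace_sub,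
      trace_smul, smul_eq_mul, hρ1, h1, h2]
    ring
  rw [hexp, trace_smul, smul_eq_mul, htr]
  have hc : (c : ℂ) ^ 2 / 2 = ((c ^ 2 / 2 : ℝ) : ℂ) := by push_cast; ring
  rw [hc, Complex.re_ofReal_mul]
  ring

end Literature.InformationTheory.StateDiscrimination.CommutingFamily

end
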